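import Literature.MathematicalPhysics.QuantumLattice.GrassmannVertexPositions
import HarnessLib

/-!
# Protected slots: the tree-decay lemma and the label sums of one script when some positions may not be pinned

Topic `Literature/MathematicalPhysics/QuantumLattice`; companion of `GrassmannVertexPositions` (`sum_kerProd_mul_lapWt_le`: with one
position of the root cluster pinned, `Σ_x ∏_u ‖K_u(x|_u)‖ · lapWt ≤ (α/2)^k ∏_u N_u`, the anchored `L¹` norms `N_u` being asked with ANY
one slot of `u` pinned) and of `KernelTreeDecay` (`sum_kernelProd_lineProd_le`, peeling the leaves).  Reading the proof of the tree-decay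
lemma (Benfatto–Giuliani–Mastropietro 2006, proof of (2.77); Gawȩdzki–Kupiainen 1985, §3) shows that the anchored norm of a cluster is
only ever used with the slot pinned WHERE THE TREE ENTERS IT: the root at the output slot `τ₀`, every other cluster at the slot of its
entering line.  So the anchored norms may be asked only at a set of PINNABLE slots containing `τ₀` and the line slots — the remaining
(“protected”) slots are never pinned.  This is the form needed when the kernels carry constraints at prescribed external legs (the
label-restricted / sectorised bookkeeping of BGM 2006 §2.4, Lemma 2.6 and (2.84)–(2.90): an external leg whose sector is prescribed is
never the leg through which the spanning tree reaches the vertex, so the vertex is estimated by its anchored norm with one FURTHER leg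
pinned — one more known sector than the prescribed ones).

* `sum_kernelProd_lineProd_le_of_pinnable` — the tree-decay lemma of `KernelTreeDecay` with a pinnability predicate `Pn` on the slots:
  kernels summed with a pinnable slot pinned are `≤ N u`; lines join pinnable slots; the root slot is pinnable; same conclusion;
* (private `sum_filter_norm_block_le_of_pinnable`), **`sum_kerProd_mul_lapWt_le_of_pinnable`** — `GrassmannVertexPositions.sum_kerProd_mul_lapWt_le`
  with the anchored norms asked only at pinnable positions, for Laplacian patterns whose steps sit at pinnable positions;

Everything is proved; no named fact.

## Sources

G. Benfatto, A. Giuliani, V. Mastropietro, Ann. Henri Poincaré 7 (2006) 809–898, proof of (2.77), §2.4 (2.84)–(2.90)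
(`BenfattoGiulianiMastropietro2006`); K. Gawȩdzki, A. Kupiainen, Comm. Math. Phys. 102 (1985) 1–30, §3 (`GawedzkiKupiainen1985GrossNeveu`).
-/

noncomputable section

namespace Literature.MathematicalPhysics.QuantumLattice

open GrassmannAlgebra Finset
open Literature.Probability.LatticeModels Literature.Probability.LatticeModels.BattleFederbush

/-! ### The tree-decay lemma with a pinnability predicate -/

section TreeDecayPinnable

variable {ι : Type*} [DecidableEq ι] {v : ι}
variable {S : Type*} [Fintype S] [DecidableEq S] {Λ : Type*} [AddCommGroup Λ] [Fintype Λ] [DecidableEq Λ]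

/-- **The tree-decay lemma for extended vertices, anchored norms asked at pinnable slots only** (Benfatto–Giuliani–Mastropietro
2006, proof of (2.77)): as `KernelTreeDecay.sum_kernelProd_lineProd_le`, but the hypothesis `Σ_{slot τ of u pinned} K u ≤ N u` is asked
only for slots with `Pn τ`, the lines join slots with `Pn`, and the pinned root slot has `Pn`; then, the slots outside the script frozen,
`Σ_x (∏_{u ∈ script} K u x) ∏_{ℓ ∈ lines} w ℓ x ≤ N(root) · Γ^k · ∏_{m=1}^{k} N(y_m)`. [cite: BenfattoGiulianiMastropietro2006, proof of (2.77)] -/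
theorem sum_kernelProd_lineProd_le_of_pinnable (cS : S → ι) (Pn : S → Prop) (K : ι → (S → Λ) → ℝ) (hK0 : ∀ u x, 0 ≤ K u x)
    (hKloc : ∀ u x x', (∀ τ, cS τ = u → x τ = x' τ) → K u x = K u x')
    (N : ι → ℝ) (hKN : ∀ u τ, cS τ = u → Pn τ → ∀ a : Λ,
      ∑ x ∈ univ.filter (fun x : S → Λ => x τ = a ∧ ∀ τ', cS τ' ≠ u → x τ' = 0), K u x ≤ N u)
    {Γ : ℝ} (hΓ : 0 ≤ Γ) (w : Sym2 ι → (S → Λ) → ℝ) :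
    ∀ {k : ℕ} (s : Script v k), s.Valid →
      (∀ ℓ ∈ s.lines, ∃ (τ₁ τ₂ : S) (h : Λ → Λ → ℝ), s(cS τ₁, cS τ₂) = ℓ ∧ Pn τ₁ ∧ Pn τ₂ ∧
        (∀ x, w ℓ x = h (x τ₁) (x τ₂)) ∧ (∀ b b', 0 ≤ h b b') ∧
        (∀ b, ∑ b', h b b' ≤ Γ) ∧ (∀ b', ∑ b, h b b' ≤ Γ)) →
      ∀ (τ₀ : S), cS τ₀ = v → Pn τ₀ → ∀ a : Λ,
        ∑ x ∈ univ.filter (fun x : S → Λ => x τ₀ = a ∧ ∀ τ, cS τ ∉ univ.image s.y → x τ = 0),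
            (∏ u ∈ univ.image s.y, K u x) * (s.lines.map fun ℓ => w ℓ x).prod ≤
          N v * (Γ ^ k * ∏ m : Fin k, N (s.y m.succ))
  | _, Script.nil, _, _, τ₀, hτ₀, hP₀, a => by
    rw [Script.image_y_nil, pow_zero, one_mul, Fintype.prod_empty, mul_one]
    simp only [prod_singleton, Script.lines, List.map_nil, List.prod_nil, mul_one, mem_singleton]
    simpa using hKN v τ₀ hτ₀ hP₀ a
  | k + 1, Script.snoc s i z, hv, hw, τ₀, hτ₀, hP₀, a => by
    classical
    obtain ⟨hs, hz⟩ := hv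
    set Q := (univ : Finset (Fin (k + 1))).image s.y with hQ
    have hzQ : z ∉ Q := fun h => by
      obtain ⟨m, -, hm⟩ := mem_image.1 h; exact hz m hm
    have hvQ : v ∈ Q := mem_image.2 ⟨0, mem_univ _, Script.y_zero s⟩
    have hτ₀Q : cS τ₀ ∈ Q := hτ₀ ▸ hvQ
    -- the last line and its two-slot weight
    have hlines : (Script.snoc s i z).lines = s.lines ++ [s(s.y i, z)] := rfl
    obtain ⟨τ₁, τ₂, h, h12, hP₁, hP₂, hwh, hh0, hrow, hcol⟩ := hw s(s.y i, z) (by rw [hlines]; simp)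
    -- the induction hypothesis
    have ih := sum_kernelProd_lineProd_le_of_pinnable cS Pn K hK0 hKloc N hKN hΓ w s hs
      (fun ℓ hℓ => hw ℓ (by rw [hlines]; exact List.mem_append_left _ hℓ)) τ₀ hτ₀ hP₀ a
    -- nonnegativity of the old weight
    have hR0 : ∀ x : S → Λ, 0 ≤ (∏ u ∈ Q, K u x) * (s.lines.map fun ℓ => w ℓ x).prod := fun x => by
      refine mul_nonneg (prod_nonneg fun u _ => hK0 u x) (List.prod_nonneg fun r hr => ?_)
      obtain ⟨ℓ, hℓ, rfl⟩ := List.mem_map.1 hr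
      obtain ⟨σ₁, σ₂, h', -, -, -, hwh', hh0', -, -⟩ := hw ℓ (by rw [hlines]; exact List.mem_append_left _ hℓ)
      rw [hwh']; exact hh0' _ _
    have hNz : 0 ≤ N z := by
      rcases Sym2.eq_iff.1 h12 with ⟨-, h2⟩ | ⟨h1, -⟩
      · exact le_trans (sum_nonneg fun y _ => hK0 z y) (hKN z τ₂ h2 hP₂ 0)
      · exact le_trans (sum_nonneg fun y _ => hK0 z y) (hKN z τ₁ h1 hP₁ 0)
    -- split off the slots of `z`
    rw [Script.image_y_snoc, sum_filter_insert_eq_sum_sum cS Q hzQ hτ₀Q a]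
    -- the summand at `x' + y`
    have hsummand : ∀ x' ∈ univ.filter (fun x : S → Λ => x τ₀ = a ∧ ∀ τ, cS τ ∉ Q → x τ = 0),
        ∀ y ∈ univ.filter (fun y : S → Λ => ∀ τ, cS τ ≠ z → y τ = 0),
        (∏ u ∈ insert z Q, K u (x' + y)) * ((Script.snoc s i z).lines.map fun ℓ => w ℓ (x' + y)).prod =
          ((∏ u ∈ Q, K u x') * (s.lines.map fun ℓ => w ℓ x').prod) *
            (K z y * h ((x' + y) τ₁) ((x' + y) τ₂)) := by
      intro x' hx' y hy
      obtain ⟨-, hx0⟩ := (mem_filter.1 hx').2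
      have hy0 := (mem_filter.1 hy).2
      have hoff : ∀ τ, cS τ ≠ z → (x' + y) τ = x' τ := fun τ hτ => by
        rw [Pi.add_apply, hy0 τ hτ, add_zero]
      have hon : ∀ τ, cS τ = z → (x' + y) τ = y τ := fun τ hτ => by
        rw [Pi.add_apply, hx0 τ (hτ ▸ hzQ), zero_add]
      have hKQ : ∏ u ∈ Q, K u (x' + y) = ∏ u ∈ Q, K u x' := by
        refine prod_congr rfl fun u hu => hKloc u _ _ fun τ hτ => hoff τ ?_
        rintro rfl; exact hzQ (hτ ▸ hu)
      have hKz : K z (x' + y) = K z y := hKloc z _ _ fun τ hτ => hon τ hτ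
      have hwQ : (s.lines.map fun ℓ => w ℓ (x' + y)) = s.lines.map fun ℓ => w ℓ x' := by
        refine List.map_congr_left fun ℓ hℓ => ?_
        obtain ⟨σ₁, σ₂, h', h12', -, -, hwh', -, -, -⟩ := hw ℓ (by rw [hlines]; exact List.mem_append_left _ hℓ)
        have hσ : ∀ σ ∈ s(cS σ₁, cS σ₂), cS σ₁ = σ ∨ cS σ₂ = σ → σ ≠ z := by
          intro σ hσ _ hσz
          have hm := Script.mem_image_of_mem_lines s ℓ hℓ σ (h12' ▸ hσ)
          exact hzQ (hσz ▸ hm)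
        rw [hwh', hwh', hoff σ₁ (hσ _ (Sym2.mem_mk_left _ _) (Or.inl rfl)),
          hoff σ₂ (hσ _ (Sym2.mem_mk_right _ _) (Or.inr rfl))]
      rw [prod_insert hzQ, hlines, List.map_append, List.prod_append, List.map_singleton,
        List.prod_singleton, hKQ, hKz, hwQ, hwh]
      ring
    rw [sum_congr rfl fun x' hx' => sum_congr rfl fun y hy => hsummand x' hx' y hy]
    -- the inner sum over the slots of `z`
    have hinner : ∀ x' ∈ univ.filter (fun x : S → Λ => x τ₀ = a ∧ ∀ τ, cS τ ∉ Q → x τ = 0),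
        ∑ y ∈ univ.filter (fun y : S → Λ => ∀ τ, cS τ ≠ z → y τ = 0),
          K z y * h ((x' + y) τ₁) ((x' + y) τ₂) ≤ Γ * N z := by
      intro x' hx'
      obtain ⟨-, hx0⟩ := (mem_filter.1 hx').2
      rcases Sym2.eq_iff.1 h12 with ⟨h1, h2⟩ | ⟨h1, h2⟩
      · -- `τ₁` in the parent `s.y i`, `τ₂` in the new point `z`
        have h1z : cS τ₁ ≠ z := by rw [h1]; exact fun h' => hz i h'
        calc ∑ y ∈ univ.filter (fun y : S → Λ => ∀ τ, cS τ ≠ z → y τ = 0),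
              K z y * h ((x' + y) τ₁) ((x' + y) τ₂)
            = ∑ y ∈ univ.filter (fun y : S → Λ => ∀ τ, cS τ ≠ z → y τ = 0),
                K z y * h (x' τ₁) (y τ₂) := by
              refine sum_congr rfl fun y hy => ?_
              have hy0 := (mem_filter.1 hy).2
              rw [Pi.add_apply, Pi.add_apply, hy0 τ₁ h1z, add_zero, hx0 τ₂ (h2 ▸ hzQ), zero_add]
          _ ≤ Γ * N z := sum_kernel_mul_twoPoint_le cS (K z) (hK0 z) (hKN z τ₂ h2 hP₂) (h (x' τ₁))
              (hh0 _) (hrow _)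
      · -- `τ₁` in the new point `z`, `τ₂` in the parent
        have h2z : cS τ₂ ≠ z := by rw [h2]; exact fun h' => hz i h'
        calc ∑ y ∈ univ.filter (fun y : S → Λ => ∀ τ, cS τ ≠ z → y τ = 0),
              K z y * h ((x' + y) τ₁) ((x' + y) τ₂)
            = ∑ y ∈ univ.filter (fun y : S → Λ => ∀ τ, cS τ ≠ z → y τ = 0),
                K z y * (fun b => h b (x' τ₂)) (y τ₁) := by
              refine sum_congr rfl fun y hy => ?_
              have hy0 := (mem_filter.1 hy).2
              rw [Pi.add_apply, Pi.add_apply, hy0 τ₂ h2z, add_zero, hx0 τ₁ (h1 ▸ hzQ), zero_add]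
          _ ≤ Γ * N z := sum_kernel_mul_twoPoint_le cS (K z) (hK0 z) (hKN z τ₁ h1 hP₁) (fun b => h b (x' τ₂))
              (fun b => hh0 _ _) (hcol _)
    -- assemble
    calc ∑ x' ∈ univ.filter (fun x : S → Λ => x τ₀ = a ∧ ∀ τ, cS τ ∉ Q → x τ = 0),
          ∑ y ∈ univ.filter (fun y : S → Λ => ∀ τ, cS τ ≠ z → y τ = 0),
            ((∏ u ∈ Q, K u x') * (s.lines.map fun ℓ => w ℓ x').prod) *
              (K z y * h ((x' + y) τ₁) ((x' + y) τ₂))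
        = ∑ x' ∈ univ.filter (fun x : S → Λ => x τ₀ = a ∧ ∀ τ, cS τ ∉ Q → x τ = 0),
            ((∏ u ∈ Q, K u x') * (s.lines.map fun ℓ => w ℓ x').prod) *
              ∑ y ∈ univ.filter (fun y : S → Λ => ∀ τ, cS τ ≠ z → y τ = 0),
                K z y * h ((x' + y) τ₁) ((x' + y) τ₂) := by
          refine sum_congr rfl fun x' _ => ?_
          rw [Finset.mul_sum]
      _ ≤ ∑ x' ∈ univ.filter (fun x : S → Λ => x τ₀ = a ∧ ∀ τ, cS τ ∉ Q → x τ = 0),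
            ((∏ u ∈ Q, K u x') * (s.lines.map fun ℓ => w ℓ x').prod) * (Γ * N z) :=
          sum_le_sum fun x' hx' => mul_le_mul_of_nonneg_left (hinner x' hx') (hR0 x')
      _ ≤ N v * (Γ ^ k * ∏ m : Fin k, N (s.y m.succ)) * (Γ * N z) := by
          rw [← Finset.sum_mul]
          exact mul_le_mul_of_nonneg_right ih (mul_nonneg hΓ hNz)
      _ = N v * (Γ ^ (k + 1) * ∏ m : Fin (k + 1), N ((Script.snoc s i z).y m.succ)) := by
          rw [Fin.prod_univ_castSucc, pow_succ]
          have hlast : (Script.snoc s i z).y (Fin.last k).succ = z := by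
            rw [Fin.succ_last, Script.y_snoc_last]
          have hcast : ∀ m : Fin k, (Script.snoc s i z).y m.castSucc.succ = s.y m.succ := fun m => by
            rw [Fin.succ_castSucc, Script.y_snoc_castSucc]
          simp only [hlast, hcast]
          ring

end TreeDecayPinnable

/-! ### The label sums of one script with protected positions -/

section TreeDecay

variable {𝕜 : Type*} [RCLike 𝕜] {Γ : Type*} [Fintype Γ] [DecidableEq Γ] {n : ℕ} (C : Matrix Γ Γ 𝕜) (cl : Γ → Fin n)
variable {deg : Fin n → ℕ} (K : ∀ v : Fin n, (Fin (deg v) → Γ) → 𝕜)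

/-- **The anchored sums of a block kernel at a pinnable position**: with the pinnable slot `τ` of `u` pinned at `a` and the positions
outside `u` frozen at `0`, `Σ_x ‖K_u(x|_u)‖ ≤ N_u`. [folklore] -/
private theorem sum_filter_norm_block_le_of_pinnable [AddCommGroup Γ] (Pn : Fin (∑ v, deg v) → Prop) (Nv : Fin n → ℝ)
    (hN : ∀ u (j : Fin (deg u)), Pn (blockEmb deg u j) → ∀ a : Γ,
      ∑ Yu ∈ univ.filter (fun Yu : Fin (deg u) → Γ => Yu j = a), ‖K u Yu‖ ≤ Nv u)
    (u : Fin n) (τ : Fin (∑ v, deg v)) (hτ : vert deg τ = u) (hPτ : Pn τ) (a : Γ) :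
    ∑ x ∈ univ.filter (fun x : Fin (∑ v, deg v) → Γ => x τ = a ∧ ∀ τ', vert deg τ' ≠ u → x τ' = 0),
      ‖K u fun j => x (blockEmb deg u j)‖ ≤ Nv u := by
  subst hτ
  set F := univ.filter (fun x : Fin (∑ v, deg v) → Γ => x τ = a ∧ ∀ τ', vert deg τ' ≠ vert deg τ → x τ' = 0) with hF
  set g : (Fin (∑ v, deg v) → Γ) → (Fin (deg (vert deg τ)) → Γ) := fun x j => x (blockEmb deg (vert deg τ) j) with hg
  have hinj : Set.InjOn g F := by
    intro x hx x' hx' hxx'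
    funext i
    by_cases hi : vert deg i = vert deg τ
    · obtain ⟨j, rfl⟩ := exists_eq_blockEmb deg hi
      exact congrFun hxx' j
    · rw [(mem_filter.1 (Finset.mem_coe.1 hx)).2.2 i hi, (mem_filter.1 (Finset.mem_coe.1 hx')).2.2 i hi]
  have hsum : ∑ x ∈ F, ‖K (vert deg τ) fun j => x (blockEmb deg (vert deg τ) j)‖ = ∑ Y ∈ F.image g, ‖K (vert deg τ) Y‖ := by
    rw [sum_image hinj]
  rw [hsum]
  have hPj : Pn (blockEmb deg (vert deg τ) (finSigmaFinEquiv.symm τ).2) := by rwa [blockEmb_vert]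
  refine le_trans (sum_le_sum_of_subset_of_nonneg (fun Y hY => ?_) fun _ _ _ => norm_nonneg _)
    (hN (vert deg τ) (finSigmaFinEquiv.symm τ).2 hPj a)
  obtain ⟨x, hx, rfl⟩ := mem_image.1 hY
  rw [mem_filter]
  refine ⟨mem_univ _, ?_⟩
  show x (blockEmb deg (vert deg τ) (finSigmaFinEquiv.symm τ).2) = a
  rw [blockEmb_vert]
  exact (mem_filter.1 hx).2.1

/-- **The tree-decay lemma applied to one script and one consistent pattern, anchored norms at pinnable positions only**
(Benfatto–Giuliani–Mastropietro 2006, proof of (2.77)): as `sum_kerProd_mul_lapWt_le`, but the anchored `L¹` norms `≤ N_u` are asked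
only with a PINNABLE slot pinned, for a pattern whose steps sit at pinnable positions and a pinnable root position `p₀`:
`Σ_{x : x_{p₀} = w} ∏_u ‖K_u(x|_u)‖ · lapWt(lines, π, x) ≤ (α/2)^k ∏_u N_u`. [cite: BenfattoGiulianiMastropietro2006, proof of (2.77)] -/
theorem sum_kerProd_mul_lapWt_le_of_pinnable (Pn : Fin (∑ v, deg v) → Prop) (Nv : Fin n → ℝ) (hN0 : ∀ u, 0 ≤ Nv u)
    (hN : ∀ u (j : Fin (deg u)), Pn (blockEmb deg u j) → ∀ a : Γ,
      ∑ Yu ∈ univ.filter (fun Yu : Fin (deg u) → Γ => Yu j = a), ‖K u Yu‖ ≤ Nv u)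
    {α : ℝ} (hα : 0 ≤ α) (hrow : ∀ ℓ X, ∑ Y, ‖typeRestrict C cl ℓ X Y‖ ≤ α) (hcol : ∀ ℓ Y, ∑ X, ‖typeRestrict C cl ℓ X Y‖ ≤ α)
    {v₀ : Fin n} {k : ℕ} (s : Script v₀ k) (hs : s.Valid) (hcov : univ.image s.y = univ)
    (π : List (Fin (∑ v, deg v) × Fin (∑ v, deg v))) (hπ : ∀ pq ∈ π, Pn pq.1 ∧ Pn pq.2)
    (p₀ : Fin (∑ v, deg v)) (hp₀ : vert deg p₀ = v₀) (hP₀ : Pn p₀) (w : Γ) :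
    ∑ x ∈ univ.filter (fun x : Fin (∑ v, deg v) → Γ => x p₀ = w), kerProd K x * lapWt C cl deg s.lines.reverse π x ≤
      (α / 2) ^ k * ∏ u, Nv u := by
  have hRHS : 0 ≤ (α / 2) ^ k * ∏ u, Nv u := mul_nonneg (pow_nonneg (by positivity) _) (prod_nonneg fun u _ => hN0 u)
  have hnd : s.lines.reverse.Nodup := List.nodup_reverse.2 (Script.nodup_lines s hs)
  by_cases hc : stepsOK (s.lines.reverse.map (lapPred deg)) π = true
  swap
  · refine le_trans (le_of_eq (sum_eq_zero fun x _ => ?_)) hRHS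
    rw [lapWt_eq C cl x _ π hnd, if_neg hc, mul_zero]
  -- the tree-decay lemma, in a transported (opaque) group structure of `Γ`
  haveI : Nonempty Γ := ⟨w⟩
  haveI : NeZero (Fintype.card Γ) := ⟨Fintype.card_ne_zero⟩
  obtain ⟨_instACG⟩ : Nonempty (AddCommGroup Γ) := ⟨(Fintype.equivFin Γ).addCommGroup⟩
  have hlines : ∀ ℓ ∈ s.lines, ∃ (τ₁ τ₂ : Fin (∑ v, deg v)) (h : Γ → Γ → ℝ), s(vert deg τ₁, vert deg τ₂) = ℓ ∧ Pn τ₁ ∧ Pn τ₂ ∧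
      (∀ x : Fin (∑ v, deg v) → Γ, lineWt C cl (s.lines.reverse.zip π) ℓ x = h (x τ₁) (x τ₂)) ∧ (∀ b b', 0 ≤ h b b') ∧
      (∀ b, ∑ b', h b b' ≤ α / 2) ∧ (∀ b', ∑ b, h b b' ≤ α / 2) := by
    intro ℓ hℓ
    obtain ⟨pq, hfind, hpq⟩ := exists_find_of_stepsOK (deg := deg) s.lines.reverse π hc ℓ (List.mem_reverse.2 hℓ)
    have hmem : pq ∈ π := (List.of_mem_zip (List.mem_of_find?_eq_some hfind)).2
    refine ⟨pq.2, pq.1, fun b b' => 1 / 2 * ‖typeRestrict C cl ℓ b b'‖, hpq, (hπ pq hmem).2, (hπ pq hmem).1,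
      fun x => by rw [lineWt, hfind], fun b b' => by positivity, fun b => ?_, fun b' => ?_⟩
    · rw [← mul_sum]; linarith [hrow ℓ b]
    · rw [← mul_sum]; linarith [hcol ℓ b']
  have hR : Nv v₀ * ((α / 2) ^ k * ∏ m : Fin k, Nv (s.y m.succ)) = (α / 2) ^ k * ∏ u, Nv u := by
    have hprod : ∏ u, Nv u = ∏ m : Fin (k + 1), Nv (s.y m) := by
      rw [← prod_image (s := univ) (g := s.y) (f := Nv) fun m _ m' _ h => Script.y_injective s hs h, hcov]
    rw [hprod, Fin.prod_univ_succ, Script.y_zero]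
    ring
  have hE := sum_kernelProd_lineProd_le_of_pinnable (Λ := Γ) (vert deg) Pn (fun u x => ‖K u fun j => x (blockEmb deg u j)‖)
    (fun u x => norm_nonneg _)
    (fun u x x' hxx' => by
      show ‖K u fun j => x (blockEmb deg u j)‖ = ‖K u fun j => x' (blockEmb deg u j)‖
      rw [show (fun j => x (blockEmb deg u j)) = fun j => x' (blockEmb deg u j) from funext fun j => hxx' _ (vert_blockEmb deg u j)])
    Nv (fun u τ hτ hPτ a => by convert sum_filter_norm_block_le_of_pinnable K Pn Nv hN u τ hτ hPτ a using 3) (Γ := α / 2) (by positivity)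
    (fun ℓ x => lineWt C cl (s.lines.reverse.zip π) ℓ x) s hs hlines p₀ hp₀ hP₀ w
  have hE' : ∑ x ∈ univ.filter (fun x : Fin (∑ v, deg v) → Γ => x p₀ = w ∧ ∀ τ, vert deg τ ∉ univ.image s.y → x τ = 0),
      (∏ u ∈ univ.image s.y, ‖K u fun j => x (blockEmb deg u j)‖) * (s.lines.map fun ℓ => lineWt C cl (s.lines.reverse.zip π) ℓ x).prod ≤
      Nv v₀ * ((α / 2) ^ k * ∏ m : Fin k, Nv (s.y m.succ)) := by
    convert hE using 3
  refine le_trans (le_of_eq ?_) (hE'.trans_eq hR)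
  refine sum_congr (filter_congr fun x _ => ?_) fun x _ => ?_
  · simp [hcov]
  · rw [hcov, lapWt_eq C cl x _ π hnd, if_pos hc, List.map_reverse, List.prod_reverse]
    rfl

end TreeDecay

end Literature.MathematicalPhysics.QuantumLattice
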